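import Mathlib.Topology.Algebra.Group.Basic
import Mathlib.Topology.LocallyConstant.Basic
import Mathlib.Topology.Algebra.Support
import HarnessLib

/-!
# A locally constant function with compact support on a topological group is UNIFORMLY locally constant:
# it is invariant under right (and left) translation by a neighbourhood of `1`

Topic `Topology`; namespace `Literature.Topology`.  THEOREMS ONLY (no definition, no instance, no notation, no named fact, no `sorry`); folklore.
The tree has the COMPACT-GROUP version (`exists_nhds_one_forall_mul_eq_of_isLocallyConstant` in
`Literature/NumberTheory/GaloisRepresentations/TateProjectiveLiftingH2Proofs`); this file is the version for a compactly supported function on an ARBITRARY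
topological group — the form in which it is used for test functions `f ∈ C_c^∞(G)` on a locally profinite group (`f` is bi-invariant under a compact open
subgroup: Bernstein–Zelevinsky (1976) §1.1; Cartier (1979) §1.1).  Consumer: cell `pub/hodgecm-mathlib`, crux H413, road «R1LL-tree» (β) LAYER 2b §4 (the common
LEVEL `m` of the finitely many cover pieces of a test function), F0P3-p01 (g13).  HC_CM is proved only modulo the printed citations until rung 0 closes; this file is
pure topology.

* `exists_nhds_one_forall_mul_eq_of_hasCompactSupport` — `∃ V ∈ 𝓝 1, ∀ g, ∀ v ∈ V, f (g * v) = f g`.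
* `exists_nhds_one_forall_mul_eq_of_hasCompactSupport'` — the left version `f (v * g) = f g`.
* `exists_forall_mul_eq_of_hasCompactSupport_of_basis` — with a family `K : ι → Set G` that enters every neighbourhood of `1` (`∀ V ∈ 𝓝 1, ∃ i, K i ⊆ V`; e.g. congruence
  subgroups), some `K i` acts trivially on the right.

## References
* [BernsteinZelevinsky1976] I. N. Bernstein, A. V. Zelevinsky, *Representations of the group GL(n, F) where F is a non-archimedean local field*, Russian Math. Surveys 31
  (1976): §1.1 (locally constant compactly supported functions are uniformly locally constant).
* [CartierCorvallis1979] P. Cartier, *Representations of p-adic groups: a survey*, Proc. Sympos. Pure Math. 33 Part 1 (1979): §1.1 p. 112.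
-/

set_option autoImplicit false

open Topology Filter Set

namespace Literature.Topology

variable {G : Type*} [Group G] [TopologicalSpace G] [IsTopologicalGroup G] {Y : Type*} [Zero Y]

/-- **UNIFORM LOCAL CONSTANCY (right).**  A locally constant function with compact support on a topological group is invariant under right translation by a
neighbourhood of `1`: `∃ V ∈ 𝓝 1, ∀ g, ∀ v ∈ V, f (g * v) = f g`.  (The set `{(x, v) | f (x * v) = f x}` is open — `f` is locally constant — and contains
`tsupport f × {1}`; the generalised tube lemma gives an open `V₁ ∋ 1` working on the support, and `V := V₁ ∩ V₁⁻¹` works everywhere.)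
[cite: BernsteinZelevinsky1976, §1.1] [cite: CartierCorvallis1979, §1.1 p. 112] -/
theorem exists_nhds_one_forall_mul_eq_of_hasCompactSupport {f : G → Y} (hf : IsLocallyConstant f) (hfs : HasCompactSupport f) :
    ∃ V ∈ 𝓝 (1 : G), ∀ g : G, ∀ v ∈ V, f (g * v) = f g := by
  -- the «agreement set» is open and contains `tsupport f ×ˢ {1}`
  have hA : IsOpen {p : G × G | f (p.1 * p.2) = f p.1} := by
    have h1 : IsLocallyConstant fun p : G × G => f (p.1 * p.2) := hf.comp_continuous continuous_mul
    have h2 : IsLocallyConstant fun p : G × G => f p.1 := hf.comp_continuous continuous_fst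
    have h12 : IsLocallyConstant fun p : G × G => (f (p.1 * p.2), f p.1) := h1.prodMk h2
    have : {p : G × G | f (p.1 * p.2) = f p.1} = (fun p : G × G => (f (p.1 * p.2), f p.1)) ⁻¹' {q : Y × Y | q.1 = q.2} := by
      ext p; simp only [Set.mem_setOf_eq, Set.mem_preimage]
    rw [this]
    exact h12 _
  have hsub : tsupport f ×ˢ ({1} : Set G) ⊆ {p : G × G | f (p.1 * p.2) = f p.1} := by
    rintro ⟨x, v⟩ ⟨-, hv⟩
    simp only [Set.mem_singleton_iff] at hv
    simp only [Set.mem_setOf_eq, hv, mul_one]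
  obtain ⟨U₁, V₁, -, hV₁o, hTU₁, h1V₁, hUV⟩ := generalized_tube_lemma hfs isCompact_singleton hA hsub
  have h1 : (1 : G) ∈ V₁ := h1V₁ (Set.mem_singleton 1)
  -- on the support, `V₁` works
  have hT : ∀ x ∈ tsupport f, ∀ v ∈ V₁, f (x * v) = f x := fun x hx v hv => by
    have := hUV (Set.mk_mem_prod (hTU₁ hx) hv)
    simpa only [Set.mem_setOf_eq] using this
  refine ⟨V₁ ∩ V₁⁻¹, Filter.inter_mem (hV₁o.mem_nhds h1) (inv_mem_nhds_one G (hV₁o.mem_nhds h1)), fun g v hv => ?_⟩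
  have hv₁ : v ∈ V₁ := hv.1
  have hv₂ : v⁻¹ ∈ V₁ := hv.2
  by_cases hg : g ∈ tsupport f
  · exact hT g hg v hv₁
  · by_cases hgv : g * v ∈ tsupport f
    · have := hT (g * v) hgv v⁻¹ hv₂
      rw [mul_inv_cancel_right] at this
      exact this.symm
    · rw [image_eq_zero_of_notMem_tsupport hg, image_eq_zero_of_notMem_tsupport hgv]

/-- **UNIFORM LOCAL CONSTANCY (left)**: `∃ V ∈ 𝓝 1, ∀ g, ∀ v ∈ V, f (v * g) = f g` (the right version for `g ↦ f g⁻¹` on `Gᵐᵒᵖ`, done directly).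
[cite: BernsteinZelevinsky1976, §1.1] [cite: CartierCorvallis1979, §1.1 p. 112] -/
theorem exists_nhds_one_forall_mul_eq_of_hasCompactSupport' {f : G → Y} (hf : IsLocallyConstant f) (hfs : HasCompactSupport f) :
    ∃ V ∈ 𝓝 (1 : G), ∀ g : G, ∀ v ∈ V, f (v * g) = f g := by
  -- apply the right version to `x ↦ f x⁻¹`
  have hf' : IsLocallyConstant fun x : G => f x⁻¹ := hf.comp_continuous continuous_inv
  have hfs' : HasCompactSupport fun x : G => f x⁻¹ := by
    have h := hfs.comp_homeomorph (Homeomorph.inv G)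
    exact h
  obtain ⟨V, hV, h⟩ := exists_nhds_one_forall_mul_eq_of_hasCompactSupport hf' hfs'
  refine ⟨V⁻¹, inv_mem_nhds_one G hV, fun g v hv => ?_⟩
  have := h g⁻¹ v⁻¹ hv
  simpa only [mul_inv_rev, inv_inv] using this

/-- **A LEVEL EXISTS**: if a family of sets `K i` enters every neighbourhood of `1` (`∀ V ∈ 𝓝 1, ∃ i, K i ⊆ V` — e.g. the congruence subgroups of a compact open
subgroup of a `p`-adic group), then a locally constant compactly supported `f` is right-invariant under some `K i`: `∃ i, ∀ g, ∀ u ∈ K i, f (g * u) = f g`.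
[cite: BernsteinZelevinsky1976, §1.1] [cite: CartierCorvallis1979, §1.1 p. 112] -/
theorem exists_forall_mul_eq_of_hasCompactSupport_of_basis {ι : Sort*} {K : ι → Set G} (hK : ∀ V ∈ 𝓝 (1 : G), ∃ i, K i ⊆ V)
    {f : G → Y} (hf : IsLocallyConstant f) (hfs : HasCompactSupport f) :
    ∃ i, ∀ g : G, ∀ u ∈ K i, f (g * u) = f g := by
  obtain ⟨V, hV, h⟩ := exists_nhds_one_forall_mul_eq_of_hasCompactSupport hf hfs
  obtain ⟨i, hi⟩ := hK V hV
  exact ⟨i, fun g u hu => h g u (hi hu)⟩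

/-- **A COMMON LEVEL FOR FINITELY MANY FUNCTIONS** along an ANTITONE family `K : ℕ → Set G` entering every neighbourhood of `1`: finitely many locally constant
compactly supported `f k` are all right-invariant under one `K m` — and under every later `K m'`, `m ≤ m'`.
[cite: BernsteinZelevinsky1976, §1.1] [cite: CartierCorvallis1979, §1.1 p. 112] -/
theorem exists_forall_forall_mul_eq_of_hasCompactSupport_of_antitone {κ : Type*} [Finite κ] {K : ℕ → Set G} (hK : ∀ V ∈ 𝓝 (1 : G), ∃ m, K m ⊆ V)
    (hKa : Antitone K) {f : κ → G → Y} (hf : ∀ k, IsLocallyConstant (f k)) (hfs : ∀ k, HasCompactSupport (f k)) :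
    ∃ m : ℕ, ∀ m', m ≤ m' → ∀ k, ∀ g : G, ∀ u ∈ K m', f k (g * u) = f k g := by
  choose m hm using fun k => exists_forall_mul_eq_of_hasCompactSupport_of_basis hK (hf k) (hfs k)
  haveI := Fintype.ofFinite κ
  refine ⟨Finset.univ.sup m, fun m' hm' k g u hu => hm k g u (hKa ((Finset.le_sup (Finset.mem_univ k)).trans hm') hu)⟩

end Literature.Topology
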